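import Literature.Geometry.Symplectic.TamingWitness
import Literature.Topology.FourManifolds.HomotopySpheres
import HarnessLib

/-!
# Near-symplectic forms on a punctured homotopy 4-sphere: standard end, two untwisted model tubes

Trunk `Literature/Geometry/Symplectic` (next to `StandardEnd.lean`, `TamingWitness.lean`).  Named
fact (D-0014) requested by route `SmoothPoincare4/SullivanDual`, crux `HyperbolicEnd`
(`stmt-SmoothPoincare4-7825`), line `taubes-circle-pencil`, stub S1 `stub_nearSymplecticData` —
and, with the same mathematical content, crux `Target` (`stmt-SmoothPoincare4-7823`), line
`last-twisted-circle`, stub `stub_nearSymplecticNormalForm` —, stated over the tree's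
`Literature.Topology.FourManifolds.HomotopySphere 4` (`HomotopySpheres.lean`),
`Literature.Geometry.Symplectic.punctured` / `InPuncturedChartBall` (`StandardEnd.lean`),
`Literature.Geometry.Symplectic.IsStandardOnBall` (`TamingWitness.lean`) and
`Literature.Geometry.Kaehler.MForm` / `IsSmoothForm` / `IsClosedForm` (`ManifoldForms.lean`).

## The printed results and the derivation being packaged

A closed `2`-form `ω` on an oriented `4`-manifold is *near-symplectic* if at every point either
`ω ∧ ω > 0` or `ω = 0` and the intrinsic gradient `∇ω : T_x X → Λ² T*_x X` has rank `3` (Perutz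
2006, Def. 1.1; Gerig 2021, §1); its zero set is a finite union of embedded circles, each *even*
(= *untwisted*) or *odd* (= *twisted*) according to the splitting `N_Z = L⁺ ⊕ L⁻` of the normal
bundle (Perutz 2006, Prop. 2.2; Gerig 2021, §1).  Let `Σ` be a homotopy `4`-sphere, `p ∈ Σ`,
`e = extChartAt (𝓡 4) p` the preferred chart, `B*_ε` the punctured chart-ball
(`InPuncturedChartBall p ε`) and `φ = ι ∘ (e − e p) : B*_ε → ℝ⁴ ∖ B̄(1/ε)` (`ι` the inversion of
`StandardEnd.lean`), a diffeomorphism onto a neighbourhood of infinity.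

1. **Existence (Gerig 2021, Thm. 1.6, asserted by Taubes, MRL 13 (2006); proof sketched in
   Gerig's Appendix §7: `L²`-Hodge theory on the cylindrical completion, Honda's transversality rel
   the end, cut-off to the model).**  "There exist (exact) near-symplectic forms on `X*` which are
   asymptotically standard."  Here `X* = Σ ∖ p`, asymptotically Euclidean through `φ` (the
   complement of the compact `Σ ∖ e⁻¹(ball(e p, ε))` is `B*_ε ≅_φ ℝ⁴ ∖ B̄(1/ε)`; `e⁻¹` of a closed
   round ball is a smoothly embedded closed `4`-ball, and any two such are ambient isotopic up to
   orientation — Cerf–Palais, Gerig 2021 Thm. 1.3 —; `Σ` with either orientation is a homotopy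
   sphere, so the orientation of `Σ ∖ p` may be taken to make `φ` orientation-preserving), and
   "asymptotically standard" = equal to `ω_std` off a compact set under the end chart.  Concretely
   `Σ ∖ p = (Σ ∖ D̊) ∪ (D ∖ p)` for the chart ball `D = e⁻¹(closedBall (e p) ε)`, and
   `ι ∘ ((e − e p)/ε)` identifies `D ∖ p` with `ℝ⁴ ∖ B⁴(1)` and is the identity of `∂D ≅ S³` — this
   is exactly Gerig's "remove a standard closed ball, attach `[0, ∞) × S³ ≅ ℝ⁴ ∖ B⁴`"; the end
   chart is `ε φ`, so Gerig's form equals `ε² φ*ω₀` near `p`, and dividing it by the constant `ε²`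
   (before steps 2–3, which are insensitive to it) gives a near-symplectic form equal to `φ*ω₀` on a
   smaller punctured chart-ball: the clause `IsStandardOnBall p ε sf` (`ω₀ = stdSymplecticForm` is
   Gerig's `ω_std` up to a permutation of coordinates).
2. **Two untwisted zero circles, no twisted one (Gerig 2021, §1 (paragraph after Thm. 1.6) and
   §3 (first paragraph): "Fix an asymptotically standard near-symplectic form `ω` on `X*` having
   `N ≥ 0` untwisted zero-circles (`N` is even) and no twisted zero-circles, which exists by
   Theorem 1.6"; the modifications are Luttinger's trade of a twisted circle for two untwisted ones
   and Perutz 2006, Thm. 1.4 (two circles are fused, or one is split, by a near-symplectic cobordism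
   constant off a ball; the fused circle is even iff the two parities differ), Prop. 1.5 / Rem. 1.9
   (a pair of even circles is born in a Darboux ball), Thm. 1.8 (parity; on `X*` the number of
   untwisted circles is even, Gerig §1)).**  All modifications are supported in compact balls of
   `Σ ∖ p`, hence keep the form standard on a smaller punctured chart-ball;
   `(N, 0) → (N − 2, 1) → (N − 2, 0)` (fuse two even circles, then the odd one with an even one)
   reduces even `N ≥ 4` to `N = 2`, and `N = 0 → 2` by a birth pair.
3. **Exact local model along an untwisted circle (Honda 2004, §4: Thm. 4 (A) — the `S¹`-invariant
   self-dual harmonic model `ω_A = ⋆₃ dQ + dθ ∧ dQ`, `Q = ½(x₁² + x₂²) − x₃²`, on `S¹ × D³` with the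
   product flat metric, `θ` of period `2π` — and Thm. 5: "Given an SD harmonic 2-form `ω`, there
   exists a 1-parameter family of perturbations `{ω_t}`, local near `C`, such that `ω₀ = ω`,
   `ω₁|_{N(C)}` is one of the two local forms (up to `±ω`)"; = Taubes 1998, eq. (1.1)
   `ω = dt ∧ (x dx + y dy − 2z dz) + x dy∧dz − y dx∧dz − 2z dx∧dy` and §1.c; re-proved as Perutz
   2006, Lemma 3.1.)**  After a deformation through near-symplectic forms with fixed zero set,
   supported in an arbitrarily small neighbourhood of an untwisted circle `C` (so off the end and
   off the other circle), a neighbourhood of `C` is isomorphic by a diffeomorphism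
   `χ : (ℝ/2πℤ) × D³(r) → N(C)` to `ω_A` (`−ω_A ≅ ω_A` by `(θ, x₃) ↦ (−θ, −x₃)`).  The deformation,
   not a mere change of coordinates, is essential: Moser's method alone identifies the germs only
   by a map that is `C¹`/Lipschitz at `C` (Honda 2004 Thm. 2; Perutz 2006 §3), the `1`-jet of `ω`
   along `C` being a diffeomorphism invariant.
4. **Flat toroidal coordinates (elementary).**  For `0 < δ < 1`,
   `T(y) = (arg(y₀ + i y₁), √(y₀² + y₁²) − 1, y₂, y₃)` is a diffeomorphism of the open solid torus
   `U_δ = {(√(y₀² + y₁²) − 1)² + y₂² + y₃² < δ²} ⊂ ℝ⁴` onto `(ℝ/2πℤ) × D³(δ)` carrying the core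
   circle `C₀ = {y₀² + y₁² = 1, y₂ = y₃ = 0}` onto `S¹ × {0}`, with
   `T*dθ = (y₀ dy₁ − y₁ dy₀)/(y₀² + y₁²)`, `T*dx₁ = (y₀ dy₀ + y₁ dy₁)/√(y₀² + y₁²)`, `T*dx₂ = dy₂`,
   `T*dx₃ = dy₃`; hence `T*ω_A` is the explicit function `formT y u v` of the statement
   (`dt ∧ dQ + a db∧dc + b dc∧da − 2c da∧db` on flat vectors `u, v` at `y`, `a = √(y₀²+y₁²) − 1`,
   `b = y₂`, `c = y₃`).  With `δ ≤ min(r₁, r₂)`, `Ψᵢ := χᵢ ∘ T` on `U_δ` (extended arbitrarily off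
   `U_δ`) are smooth injective immersions with `Ψᵢ* sf = formT`; shrinking `δ` and `ε` makes the
   two tube images disjoint, disjoint from `B*_ε`, and `closedBall (e p) ε ⊆ e.target`.
5. The resulting form `sf` is smooth and closed on `Σ ∖ p`, standard on `B*_ε`, and non-degenerate
   exactly off its zero set `Ψ₁(C₀) ∪ Ψ₂(C₀)` (inside the tubes it is the model, which vanishes
   exactly on the core; outside it is symplectic).

Only the END RESULT of 1–5 is recorded, as the named fact `relNearSymplecticTaubesTubes_exists`
(nothing is asserted; users take it as a hypothesis).  It implies near-symplecticity (the model's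
gradient has rank `3` along the core) without the tree having to define `∇ω` at a zero, and it is
literally the conjunction of the fields of the Summit-side package `IsNearSymplecticData`
(`Summits/SmoothPoincare4/SmoothPoincare4/Theorems/SullivanDualHyperbolicEndTaubesModelDefs.lean`)
with its `taubesForm` / `taubesTube` / `taubesCore` unfolded (Literature cannot import Summits) and
non-degeneracy asked off the two CORE circles (the printed zero set) rather than off the tubes.

## Design notes

* Orientations never enter: `formT ∧ formT = −(2/r)(a² + b² + 4c²) dy₀∧dy₁∧dy₂∧dy₃` (`T` reverses
  orientation) and `ι` reverses orientation; the tube maps `Ψᵢ` and the chart are free data, and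
  `S.orientation` is not mentioned.
* Junk values: `x / 0 = 0` on the axis `y₀ = y₁ = 0`, which `U_δ` misses for `δ < 1`; `Ψᵢ` are
  total functions constrained only on `U_δ`; `arg` is not used (only `d(arg)`, which is smooth).
* The circle has period `2π` as in Honda 2004 (Taubes 1998 §1.c and Perutz 2006 normalise `ℝ/ℤ`;
  the deformation of step 3 absorbs the scale, cf. Perutz's `θ_s = (1 − s)ω + sΘ`).
* Mathlib has no near-symplectic / self-dual harmonic forms on manifolds (only the pointwise
  linear algebra `Literature.Geometry.GaugeTheory.IsSelfDualTwo` exists in the tree); the tree's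
  forms are `Literature.Geometry.Kaehler.MForm`.  Searched (`lean search`): `NearSymplectic`,
  `nearSymplectic`, `selfDual.*harmonic`, `zeroCircle`, `untwisted`, `Honda`, `Gerig` — in
  `Literature/` only docstring mentions (`Barriers/SmoothPoincare4/GaugeInvariantsBlindProofs`).

## References

* C. Gerig, *No homotopy 4-sphere invariants using ECH=SWF*, Algebr. Geom. Topol. 21 (2021)
  2543–2569, arXiv:1905.10938, Thm. 1.3, Thm. 1.6, §1, §3, Appendix §7
  [Gerig2021NoHomotopySphereInvariants].
* K. Honda, *Local properties of self-dual harmonic 2-forms on a 4-manifold*, J. reine angew.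
  Math. 577 (2004) 105–116, arXiv:dg-ga/9705010, §4 Thm. 4 (A), Thm. 5 (arXiv numbering)
  [Honda2004LocalSD].
* T. Perutz, *Zero-sets of near-symplectic forms*, J. Symplectic Geom. 4 (2006) 237–257,
  arXiv:math/0601320, Def. 1.1, Thm. 1.4, Prop. 1.5, Thm. 1.8, Rem. 1.9, Prop. 2.2, Lemma 3.1
  [Perutz2006].
* C. H. Taubes, *The structure of pseudo-holomorphic subvarieties for a degenerate almost complex
  structure and symplectic form on `S¹ × B³`*, Geom. Topol. 2 (1998) 221–332, eq. (1.1), §1.c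
  [Taubes1998S1B3].
-/

noncomputable section

open scoped Manifold ContDiff
open TopologicalSpace Set Literature.Geometry.Kaehler

namespace Literature.Geometry.Symplectic

/-- Local notation for the model space `ℝ⁴ = EuclideanSpace ℝ (Fin 4)`. -/
local notation "E4" => EuclideanSpace ℝ (Fin 4)

/-- **Near-symplectic forms with standard end and two untwisted Taubes tubes exist on every
punctured homotopy 4-sphere (Gerig 2021 Thm. 1.6 + Perutz 2006 / Luttinger + Honda 2004 Thm. 5,
end result).**  For every homotopy `4`-sphere `Σ` and `p ∈ Σ` there are `ε > 0` with
`closedBall (e p) ε ⊆ e.target` (`e = extChartAt (𝓡 4) p`), `0 < δ < 1`, a smooth closed `2`-form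
`sf` on `Σ ∖ p` equal to the inverted-chart model `(ι ∘ (e − e p))*ω₀` on the punctured
`ε`-chart-ball (`IsStandardOnBall`: asymptotically standard), and two maps `Ψ₁, Ψ₂ : ℝ⁴ → Σ ∖ p`
which on the flat solid torus `U_δ = {(√(y₀² + y₁²) − 1)² + y₂² + y₃² < δ²}` are smooth injective
immersions avoiding the punctured `ε`-ball, with disjoint images, pulling `sf` back to Taubes'
untwisted model `formT = dt ∧ dQ + ⋆₃ dQ` (`Q = ½(a² + b² − 2c²)`, `t = arg(y₀ + iy₁)`,
`a = √(y₀² + y₁²) − 1`, `b = y₂`, `c = y₃`; = Honda's `ω_A`, `θ` of period `2π`, = Taubes 1998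
eq. (1.1), written on flat vectors `u, v` at `y`), and such that `sf` is non-degenerate at every
point off the two core circles `Ψᵢ(C₀)`, `C₀ = {y₀² + y₁² = 1, y₂ = y₃ = 0}` (so `sf` is
near-symplectic with zero set exactly two untwisted circles in model position).  Derivation from
the cited statements: module docstring, steps 1–5.  Nothing is asserted; users take
`(h : relNearSymplecticTaubesTubes_exists)`.
[cite: Gerig2021NoHomotopySphereInvariants, Thm. 1.6, §1 (after Thm. 1.6), §3 (first par.)]
[cite: Honda2004LocalSD, §4 Thm. 4 (A) and Thm. 5]
[cite: Perutz2006, Thm. 1.4, Prop. 1.5, Thm. 1.8, Rem. 1.9, Lemma 3.1]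
[cite: Taubes1998S1B3, eq. (1.1) and §1.c] -/
def relNearSymplecticTaubesTubes_exists : Prop :=
  ∀ (S : Literature.Topology.FourManifolds.HomotopySphere 4) (p : S.carrier),
    ∃ (ε δ : ℝ) (sf : MForm (𝓡 4) (punctured p) ℝ 2) (Ψ₁ Ψ₂ : E4 → punctured p),
      -- the flat solid torus `U_δ` and its core circle `C₀`
      let U : Set E4 := {y | (Real.sqrt (y 0 ^ 2 + y 1 ^ 2) - 1) ^ 2 + y 2 ^ 2 + y 3 ^ 2 < δ ^ 2}
      let C : Set E4 := {y | y 0 ^ 2 + y 1 ^ 2 = 1 ∧ y 2 = 0 ∧ y 3 = 0}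
      -- toroidal coframe: `r = √(y₀² + y₁²)`, `dt = (y₀ dy₁ − y₁ dy₀)/r²`, `da = dr`,
      -- `dQ = a da + b db − 2c dc` (`a = r − 1`, `b = y₂`, `c = y₃`)
      let r : E4 → ℝ := fun y => Real.sqrt (y 0 ^ 2 + y 1 ^ 2)
      let dt : E4 → E4 → ℝ := fun y u => (y 0 * u 1 - y 1 * u 0) / r y ^ 2
      let da : E4 → E4 → ℝ := fun y u => (y 0 * u 0 + y 1 * u 1) / r y
      let dQ : E4 → E4 → ℝ := fun y u => (r y - 1) * da y u + y 2 * u 2 - 2 * y 3 * u 3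
      -- Taubes' untwisted model `dt ∧ dQ + a db∧dc + b dc∧da − 2c da∧db` on flat vectors `u, v`
      let formT : E4 → E4 → E4 → ℝ := fun y u v =>
        dt y u * dQ y v - dt y v * dQ y u
          + (r y - 1) * (u 2 * v 3 - v 2 * u 3)
          + y 2 * (u 3 * da y v - v 3 * da y u)
          - 2 * y 3 * (da y u * v 2 - da y v * u 2)
      -- a Taubes tube of `sf`: a smooth injective immersion of `U_δ` avoiding the `ε`-ball,
      -- with `Ψ* sf = formT`
      let IsTube : (E4 → punctured p) → Prop := fun Ψ =>
        ContMDiffOn 𝓘(ℝ, E4) (𝓡 4) ∞ Ψ U ∧ Set.InjOn Ψ U ∧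
          (∀ y ∈ U, Function.Injective (mfderiv 𝓘(ℝ, E4) (𝓡 4) Ψ y)) ∧
          (∀ y ∈ U, ¬ InPuncturedChartBall p ε (Ψ y)) ∧
          (∀ y ∈ U, ∀ u v : E4,
            sf (Ψ y) ![mfderiv 𝓘(ℝ, E4) (𝓡 4) Ψ y u, mfderiv 𝓘(ℝ, E4) (𝓡 4) Ψ y v] = formT y u v)
      0 < ε ∧ Metric.closedBall (extChartAt (𝓡 4) p p) ε ⊆ (extChartAt (𝓡 4) p).target ∧
      0 < δ ∧ δ < 1 ∧
      IsSmoothForm sf ∧ IsClosedForm sf ∧ IsStandardOnBall p ε sf ∧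
      IsTube Ψ₁ ∧ IsTube Ψ₂ ∧ Disjoint (Ψ₁ '' U) (Ψ₂ '' U) ∧
      ∀ x : punctured p, x ∉ Ψ₁ '' C ∪ Ψ₂ '' C →
        ∀ v : TangentSpace (𝓡 4) x, v ≠ 0 → ∃ w : TangentSpace (𝓡 4) x, sf x ![v, w] ≠ 0

end Literature.Geometry.Symplectic

end
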